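import Mathlib.Analysis.SpecialFunctions.Exponential
import Mathlib.Topology.Algebra.Module.FiniteDimension
import Mathlib.Topology.Instances.Matrix
import Literature.NumberTheory.Automorphic.GKModuleOfDifferentiableRep
import HarnessLib

/-!
# The `φ`-standard representation `g ↦ φ(g)` of a linear real group is a `(𝔤, K)`-module

Topic `NumberTheory/Automorphic`; namespace `Literature.NumberTheory.Automorphic.RealMatrixGroup`.
Definitions with bodies and theorems; no named fact, no `sorry`.  Companion of
`GKModuleOfDifferentiableRep` and `GKModuleStandardRep`.

For a linear real group `G ≤ GL(N, A)` (`RealMatrixGroups`) and a continuous morphism of real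
algebras `φ : A →ₐ[ℝ] ℂ` — for `A = F ⊗_ℚ ℝ` the archimedean algebra of a number field these are
the complex embeddings `F ⊗ ℝ → ℂ` extending `τ : F → ℂ` (and their conjugates), through which the
algebraic coefficient systems `⨂_τ V_λ ∘ GL_n(τ)` of the cohomology of arithmetic groups
(`ParallelWeight.coeffRep`, `GLnCohomology.coeffRepGL`) are restricted to `G_∞ = GL_n(F ⊗ ℝ)`:

* `phiStdAlgHom N φ : Matrix N N A →ₐ[ℝ] End_ℂ (N → ℂ)`, `M v = φ(M) v` (`AlgHom.mapMatrix`,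
  `Matrix.toLinAlgEquiv'`);
* `phiStdRep G φ : Representation ℂ G (N → ℂ)` — **the `φ`-standard representation `g v = φ(g) v`**
  and its differential `phiStdLie G φ : 𝔤 →ₗ⁅ℝ⁆ End_ℂ (N → ℂ)`, `X v = φ(X) v`;
* `isDifferentiableRep_phiStd` — **it is differentiable** (`IsDifferentiableRep`; the coefficient
  `M ↦ ℓ (φ(M) v)` is a continuous real-linear map `phiCoeffMap`, and `d/dt exp(tX)|₀ = X`), hence
  `isGKModule_phiStd` — **restricted to `K`, with `phiStdLie`, a `(𝔤, K)`-module**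
  [cite: BorelWallach2000, 0 §2.3–2.5].

## Mathlib / Literature search

`AlgHom.mapMatrix`, `Matrix.toLinAlgEquiv'`, `Continuous.matrix_map`, `Continuous.matrix_mulVec`,
`hasDerivAt_exp_smul_const` (Mathlib); `IsDifferentiableRep.isGKModule` (tree).
`lean search 'phiStdRep|phiStdLie'`: no hits.

## References

* A. Borel, N. Wallach (2000), 0 §2.3–2.5 (held) [BorelWallach2000].
-/

noncomputable section

namespace Literature.NumberTheory.Automorphic

open Module

-- Mathlib idiom (as in `GKModules`): commutator bracket on `Module.End`
attribute [local instance 100] LieRing.ofAssociativeRing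

open scoped MatrixGroups Matrix

variable {A : Type*} [NormedCommRing A] [NormedAlgebra ℝ A] [NormedAlgebra ℚ A] [CompleteSpace A]
  [StarRing A] {N : Type*} [Fintype N] [DecidableEq N] (G : RealMatrixGroup A N)
  (φ : A →ₐ[ℝ] ℂ)

namespace RealMatrixGroup

section PhiStandard

open NormedSpace
open scoped Matrix.Norms.Operator

variable (N)

omit [NormedAlgebra ℚ A] [CompleteSpace A] [StarRing A] in
/-- `M ↦ (v ↦ φ(M) v)`: the matrix algebra over `A` acting on complex column vectors through
`φ : A → ℂ`, a morphism of real algebras. [folklore] -/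
def phiStdAlgHom : Matrix N N A →ₐ[ℝ] Module.End ℂ (N → ℂ) :=
  ((Matrix.toLinAlgEquiv' : Matrix N N ℂ ≃ₐ[ℂ] Module.End ℂ (N → ℂ)).toAlgHom.restrictScalars
    ℝ).comp φ.mapMatrix

omit [NormedAlgebra ℚ A] [CompleteSpace A] [StarRing A] in
/-- Unfolding. [folklore] -/
@[simp] theorem phiStdAlgHom_apply (M : Matrix N N A) (v : N → ℂ) :
    phiStdAlgHom N φ M v = (M.map φ) *ᵥ v :=
  Matrix.toLinAlgEquiv'_apply _ _

variable {N}

/-- **The `φ`-standard representation** of `G ≤ GL(N, A)` on `N → ℂ`: `g v = φ(g) v`.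
[cite: BorelWallach2000, 0 §2.3] -/
def phiStdRep : Representation ℂ G.carrier (N → ℂ) :=
  (phiStdAlgHom N φ).toMonoidHom.comp ((Units.coeHom (Matrix N N A)).comp G.carrier.subtype)

/-- Unfolding. [folklore] -/
@[simp] theorem phiStdRep_apply (g : G.carrier) (v : N → ℂ) :
    phiStdRep G φ g v = (((g : GL N A) : Matrix N N A).map φ) *ᵥ v :=
  phiStdAlgHom_apply N φ _ v

/-- Its differential `X v = φ(X) v`, `X ∈ 𝔤`. [cite: BorelWallach2000, 0 §2.3] -/
def phiStdLie : G.lie →ₗ⁅ℝ⁆ Module.End ℂ (N → ℂ) :=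
  (phiStdAlgHom N φ).toLieHom.comp G.lie.incl

/-- Unfolding. [folklore] -/
@[simp] theorem phiStdLie_apply (X : G.lie) (v : N → ℂ) :
    phiStdLie G φ X v = ((X : Matrix N N A).map φ) *ᵥ v :=
  phiStdAlgHom_apply N φ _ v

omit [NormedAlgebra ℚ A] [CompleteSpace A] [StarRing A] [DecidableEq N] in
/-- The matrix coefficient `M ↦ ℓ (φ(M) v)` as a real-linear map on matrices. [folklore] -/
def phiCoeffMap (ℓ : Dual ℂ (N → ℂ)) (v : N → ℂ) : Matrix N N A →ₗ[ℝ] ℂ where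
  toFun M := ℓ ((M.map φ) *ᵥ v)
  map_add' M M' := by rw [Matrix.map_add φ (map_add φ), Matrix.add_mulVec, map_add]
  map_smul' t M := by
    have h : (t • M).map φ = (t : ℂ) • M.map φ := by
      ext i j
      simp only [Matrix.map_apply, Matrix.smul_apply, map_smul, Complex.real_smul, smul_eq_mul]
    rw [h, Matrix.smul_mulVec, map_smul, RingHom.id_apply, Complex.real_smul, smul_eq_mul]

omit [NormedAlgebra ℚ A] [CompleteSpace A] [StarRing A] [DecidableEq N] in
/-- Unfolding. [folklore] -/
@[simp] theorem phiCoeffMap_apply (ℓ : Dual ℂ (N → ℂ)) (v : N → ℂ) (M : Matrix N N A) :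
    phiCoeffMap φ ℓ v M = ℓ ((M.map φ) *ᵥ v) := rfl

omit [NormedAlgebra ℚ A] [CompleteSpace A] [StarRing A] [DecidableEq N] in
/-- The coefficient map is continuous when `φ` is. [folklore] -/
theorem continuous_phiCoeffMap (hφ : Continuous φ) (ℓ : Dual ℂ (N → ℂ)) (v : N → ℂ) :
    Continuous (phiCoeffMap φ ℓ v) := by
  have hℓ : Continuous ℓ := LinearMap.continuous_of_finiteDimensional ℓ
  change Continuous fun M : Matrix N N A => ℓ ((M.map φ) *ᵥ v)
  exact hℓ.comp ((continuous_id.matrix_map hφ).matrix_mulVec continuous_const)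

/-- **The `φ`-standard representation is differentiable** with differential `phiStdLie`, for
continuous `φ` (and finite-dimensional `A`, used only for the completeness of the matrix algebra in
the operator norm). [cite: BorelWallach2000, 0 §2.3] -/
theorem isDifferentiableRep_phiStd [FiniteDimensional ℝ A] (hφ : Continuous φ) :
    IsDifferentiableRep G (phiStdRep G φ) (phiStdLie G φ) where
  continuous_coeff v ℓ := by
    have h := continuous_phiCoeffMap φ hφ ℓ v
    have e : (fun g : G.carrier ↦ ℓ (phiStdRep G φ g v)) =
        phiCoeffMap φ ℓ v ∘ fun g : G.carrier ↦ ((g : GL N A) : Matrix N N A) := by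
      funext g
      rw [Function.comp_apply, phiCoeffMap_apply, phiStdRep_apply]
    rw [e]
    exact h.comp (Units.continuous_val.comp continuous_subtype_val)
  hasDerivAt_coeff X v ℓ := by
    have hexp : HasDerivAt (fun t : ℝ ↦ exp (t • (X : Matrix N N A))) (X : Matrix N N A) 0 := by
      have h := hasDerivAt_exp_smul_const (𝕂 := ℝ) (X : Matrix N N A) 0
      rwa [zero_smul, exp_zero, one_mul] at h
    let Ψ : Matrix N N A →L[ℝ] ℂ := ⟨phiCoeffMap φ ℓ v, continuous_phiCoeffMap φ hφ ℓ v⟩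
    have h := (Ψ.hasFDerivAt).comp_hasDerivAt (0 : ℝ) hexp
    have e : (fun t : ℝ ↦ ℓ (phiStdRep G φ (G.expMem (t • X)) v)) =
        Ψ ∘ fun t : ℝ ↦ exp (t • (X : Matrix N N A)) := by
      funext t
      rw [Function.comp_apply, phiStdRep_apply]
      rfl
    rw [e, phiStdLie_apply]
    exact h

variable [StarModule ℝ A] [ContinuousStar A]

/-- The `φ`-standard representation of `G` restricted to `K`, with its differential, **is a
`(𝔤, K)`-module**. [cite: BorelWallach2000, 0 §2.4–2.5] -/
theorem isGKModule_phiStd [FiniteDimensional ℝ A] (hφ : Continuous φ) :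
    IsGKModule G (restrictK G (phiStdRep G φ)) (phiStdLie G φ) :=
  (isDifferentiableRep_phiStd G φ hφ).isGKModule

end PhiStandard

end RealMatrixGroup

end Literature.NumberTheory.Automorphic
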